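import Mathlib
import Summits.MatrixMultiplication.MatrixMultiplication.Theorems.HiddenToeplitzCornersHiddenCornerLemmaRScaleVanishing
import Summits.MatrixMultiplication.MatrixMultiplication.Theorems.HiddenToeplitzCornersHiddenCornerLemmaRNoDesignReduction

/-!
# Kernel lemma: a proper subframe with the window property forces a short syzygy
# (hidden-corner lemma, crux stmt-MatrixMultiplication-10752)

Support file for crux item `stmt-MatrixMultiplication-10752`
(`Summit.MatrixMultiplication.MatrixMultiplication.Theses.HiddenToeplitzCorners.HiddenCornerLemmaR`),
line `atkinson-lloyd-core-split`, stub `hclR_short_syzygy_of_subframe` (the "kernel lemma" on top of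
the level theorem `hclR_kernel_trivial_of_scaleVanishing`, module `…ScaleVanishing`).

`Z` is the lower shift on `Fin N → ℂ` written verbatim as in the crux (`Z i j = [i = j + 1]`);
`L(g_k) = Σ_i G₀ i k • Z^i`, `A_k = Σ_i G₀ i k • (Zᵀ)^i = L(g_k)ᵀ`, `U(h) = Σ_i h i • (Zᵀ)^i`, and
the twisted evaluation of a test column `λ` on a frame vector `e` is `U(A_k λ) e`.

Statement.  Data of the G-constant dual law — constant generators `G₀ : N × p`, a frame `E : N × r`
and targets `F : N × r` of rank `r`, the annihilator hypothesis (test matrices annihilating the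
twisted evaluations on `E` kill `F`), a class member `M` (`M - Z M Zᵀ = G₀ Hᵀ`) with `M E = F X₀`
and `det M ≠ 0` — plus an injective `ι : Fin m → Fin r` with `m < r` (a PROPER subframe
`E' := E.submatrix id ι`), a degree bound `D` for the columns of `E`, and the window hypothesis for
the column span of `E'`.  Conclusion: a NONZERO short syzygy `β` (`β_k` supported in degrees `< w`,
`Σ_k L(g_k) β_k = 0`).

Proof.  Suppose not; this is the scale-vanishing hypothesis of the level theorem, which (applied to
the subframe `E'`, whose columns are columns of `E`) says: whenever a class member
`K(h) := Σ_k L(g_k) U(h_k)` kills `E'`, every `h_k` vanishes in degrees `≤ D`; then `U(h_k)` kills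
every vector supported in degrees `≤ D` (`hclR_ss_upperToeplitz_kills`), so `K(h)` kills every
column of `E` (PRIMAL KERNEL CONTAINMENT).  Dualise (`hclR_ss_dualise`): the coordinate functionals
`h ↦ (K(h) E'_c)_n` cut out a subspace contained in the kernel of `h ↦ (K(h) E_b)_{n₀}`, so the
latter functional is a combination `Σ_{c,n} Λ n c · (K(h) E'_c)_n` of the former
(`mem_span_of_iInf_ker_le_ker`); by the pairing identity `y ⬝ K(h) e = Σ_k h_k ⬝ U(A_k y) e`
(`hclR_ss_pairing`, the Hankel symmetry `x ⬝ U(h) e = h ⬝ U(x) e`) this reads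
`Σ_c U(A_k Λᵀ c) E'_c = U(A_k δ_{n₀}) E_b` for every `k`.  Absorption (as in
`hclR_gconstDualLaw_of_phiInj`): for a column `b ∉ range ι` the test matrix "`Λ` on the columns `ι`,
`-δ_{n₀}` on column `b`" is annihilated, so the annihilator hypothesis gives `F n₀ a = 0`; hence
`F = 0`, contradicting `rank F = r > m ≥ 0`.  (For `p = 0` the same argument runs verbatim: the
annihilation condition is vacuous.)

* `hclR_ss_shiftT_symm`, `hclR_ss_form_symm`, `hclR_ss_pairing` — the Hankel symmetry and the
  pairing identity;
* `hclR_ss_exists_linear` — `h ↦ K(h) e` is `ℂ`-linear;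
* `hclR_ss_ext_of_pairing` — extraction of components from `∀ h, Σ_k h_k ⬝ X_k = Σ_k h_k ⬝ Y_k`;
* `hclR_ss_dualise` — primal kernel containment ⇒ dual test matrix;
* `hclR_ss_upperToeplitz_kills`, `hclR_ss_transpose_L`, `hclR_ss_exists_avoid` — bookkeeping;
* `hclR_short_syzygy_of_subframe` — the registered statement.
-/

set_option linter.dupNamespace false

namespace Summit.MatrixMultiplication.MatrixMultiplication.Theorems

open Matrix BigOperators Finset

/-- Hankel symmetry of the up-shifts: `((Zᵀ)^i v)_j = v_{i+j} = ((Zᵀ)^j v)_i`. -/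
theorem hclR_ss_shiftT_symm {N : ℕ} (v : Fin N → ℂ) (i j : Fin N) :
    ((Matrix.of fun i j : Fin N => if (i : ℕ) = (j : ℕ) + 1 then (1 : ℂ) else 0)ᵀ ^ (i : ℕ) *ᵥ
        v) j =
      ((Matrix.of fun i j : Fin N => if (i : ℕ) = (j : ℕ) + 1 then (1 : ℂ) else 0)ᵀ ^ (j : ℕ) *ᵥ
        v) i := by
  rw [hclR_shiftT_pow_mulVec, hclR_shiftT_pow_mulVec]
  by_cases h : (j : ℕ) + (i : ℕ) < N
  · have h' : (i : ℕ) + (j : ℕ) < N := by omega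
    rw [dif_pos h, dif_pos h']
    congr 1
    exact Fin.ext (by simp only; omega)
  · have h' : ¬ ((i : ℕ) + (j : ℕ) < N) := by omega
    rw [dif_neg h, dif_neg h']

/-- Symmetry of the Hankel form: `x ⬝ U(h) e = h ⬝ U(x) e` (`U(h) = Σ_i h i • (Zᵀ)^i`), both sides
being `Σ_{n,i} x n · h i · e (n + i)`. -/
theorem hclR_ss_form_symm {N : ℕ} (x h e : Fin N → ℂ) :
    x ⬝ᵥ ((∑ i : Fin N, h i •
        (Matrix.of fun i j : Fin N => if (i : ℕ) = (j : ℕ) + 1 then (1 : ℂ) else 0)ᵀ ^ (i : ℕ)) *ᵥ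
          e) =
      h ⬝ᵥ ((∑ i : Fin N, x i •
        (Matrix.of fun i j : Fin N => if (i : ℕ) = (j : ℕ) + 1 then (1 : ℂ) else 0)ᵀ ^ (i : ℕ)) *ᵥ
          e) := by
  simp only [dotProduct, Matrix.sum_mulVec, Finset.sum_apply, Matrix.smul_mulVec, Pi.smul_apply,
    smul_eq_mul, Finset.mul_sum]
  rw [Finset.sum_comm]
  refine Finset.sum_congr rfl fun i _ => Finset.sum_congr rfl fun n _ => ?_
  rw [hclR_ss_shiftT_symm e i n]
  ring

/-- Pairing identity: `y ⬝ ((Σ_k L_k U(h_k)) e) = Σ_k h_k ⬝ U(L_kᵀ y) e` for arbitrary matrices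
`L_k` (`U(h) = Σ_i h i • (Zᵀ)^i`). -/
theorem hclR_ss_pairing {N p : ℕ} (L : Fin p → Matrix (Fin N) (Fin N) ℂ) (y e : Fin N → ℂ)
    (Hf : Fin p → Fin N → ℂ) :
    y ⬝ᵥ ((∑ k : Fin p, (L k * (∑ i : Fin N, Hf k i •
        (Matrix.of fun i j : Fin N => if (i : ℕ) = (j : ℕ) + 1 then (1 : ℂ) else 0)ᵀ ^ (i : ℕ)))) *ᵥ
          e) =
      ∑ k : Fin p, Hf k ⬝ᵥ ((∑ j : Fin N, (((L k)ᵀ *ᵥ y) j) •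
        (Matrix.of fun i j : Fin N => if (i : ℕ) = (j : ℕ) + 1 then (1 : ℂ) else 0)ᵀ ^ (j : ℕ)) *ᵥ
          e) := by
  rw [Matrix.sum_mulVec, dotProduct_sum]
  refine Finset.sum_congr rfl fun k _ => ?_
  rw [← Matrix.mulVec_mulVec, Matrix.dotProduct_mulVec, ← Matrix.mulVec_transpose,
    hclR_ss_form_symm]

/-- The class-member action `h ↦ (Σ_k L_k U(h_k)) e` (`U(h) = Σ_i h i • S^i`) is `ℂ`-linear in
`h : Fin p → (Fin N → ℂ)`. -/
theorem hclR_ss_exists_linear {N p : ℕ} (L : Fin p → Matrix (Fin N) (Fin N) ℂ)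
    (S : Matrix (Fin N) (Fin N) ℂ) (e : Fin N → ℂ) :
    ∃ Φ : (Fin p → Fin N → ℂ) →ₗ[ℂ] (Fin N → ℂ), ∀ Hf : Fin p → Fin N → ℂ,
      Φ Hf = (∑ k : Fin p, (L k * (∑ i : Fin N, Hf k i • S ^ (i : ℕ)))) *ᵥ e := by
  refine ⟨{ toFun := fun Hf => (∑ k : Fin p, (L k * (∑ i : Fin N, Hf k i • S ^ (i : ℕ)))) *ᵥ e
            map_add' := ?_
            map_smul' := ?_ }, fun _ => rfl⟩
  · intro x y
    simp only [Pi.add_apply, add_smul, Finset.sum_add_distrib, Matrix.mul_add, Matrix.add_mulVec]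
  · intro c x
    simp only [Pi.smul_apply, smul_eq_mul, RingHom.id_apply, mul_smul, ← Finset.smul_sum,
      Matrix.mul_smul, Matrix.smul_mulVec]

/-- Extraction of components: if `Σ_k h_k ⬝ X_k = Σ_k h_k ⬝ Y_k` for every `h`, then `X = Y`. -/
theorem hclR_ss_ext_of_pairing {N p : ℕ} (X Y : Fin p → Fin N → ℂ)
    (h : ∀ Hf : Fin p → Fin N → ℂ, ∑ k : Fin p, Hf k ⬝ᵥ X k = ∑ k : Fin p, Hf k ⬝ᵥ Y k) :
    X = Y := by
  funext k n
  have hk := h (Pi.single k (Pi.single n 1))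
  rw [Fintype.sum_eq_single k, Fintype.sum_eq_single k] at hk
  · simpa using hk
  · intro k' hk'
    rw [Pi.single_eq_of_ne hk', zero_dotProduct]
  · intro k' hk'
    rw [Pi.single_eq_of_ne hk', zero_dotProduct]

/-- **Dualisation.**  `L_k` arbitrary with `L_kᵀ = A_k`, `U(h) = Σ_i h i • (Zᵀ)^i`,
`K(h) = Σ_k L_k U(h_k)`.  If every `h` with `K(h) G_c = 0` for all `c` also has `K(h) e_b = 0`
(primal kernel containment), then for every coordinate `n₀` there is a test matrix `Λ : N × m` with
`Σ_c U(A_k Λᵀ c) G_c = U(A_k δ_{n₀}) e_b` for every `k` (the functional `h ↦ (K(h) e_b)_{n₀}` is a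
combination of the functionals `h ↦ (K(h) G_c)_n`, `mem_span_of_iInf_ker_le_ker`, rewritten through
the pairing identity `hclR_ss_pairing`). -/
theorem hclR_ss_dualise {N p m : ℕ} (L A : Fin p → Matrix (Fin N) (Fin N) ℂ)
    (hA : ∀ k : Fin p, (L k)ᵀ = A k) (G : Fin m → Fin N → ℂ) (eb : Fin N → ℂ) (n₀ : Fin N)
    (hprimal : ∀ Hf : Fin p → Fin N → ℂ,
      (∀ c : Fin m, (∑ k : Fin p, (L k * (∑ i : Fin N, Hf k i •
        (Matrix.of fun i j : Fin N => if (i : ℕ) = (j : ℕ) + 1 then (1 : ℂ) else 0)ᵀ ^ (i : ℕ)))) *ᵥ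
          (G c) = 0) →
      (∑ k : Fin p, (L k * (∑ i : Fin N, Hf k i •
        (Matrix.of fun i j : Fin N => if (i : ℕ) = (j : ℕ) + 1 then (1 : ℂ) else 0)ᵀ ^ (i : ℕ)))) *ᵥ
          eb = 0) :
    ∃ Λ : Matrix (Fin N) (Fin m) ℂ, ∀ k : Fin p,
      ∑ c : Fin m, (∑ j : Fin N, ((A k *ᵥ (Λᵀ c)) j) •
          (Matrix.of fun i j : Fin N => if (i : ℕ) = (j : ℕ) + 1 then (1 : ℂ) else 0)ᵀ ^ (j : ℕ)) *ᵥ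
        (G c) =
      (∑ j : Fin N, ((A k *ᵥ (Pi.single n₀ 1)) j) •
          (Matrix.of fun i j : Fin N => if (i : ℕ) = (j : ℕ) + 1 then (1 : ℂ) else 0)ᵀ ^ (j : ℕ)) *ᵥ
        eb := by
  choose Φ hΦ using fun e : Fin N → ℂ => hclR_ss_exists_linear L
    (Matrix.of fun i j : Fin N => if (i : ℕ) = (j : ℕ) + 1 then (1 : ℂ) else 0)ᵀ e
  -- the functional `h ↦ (K(h) e_b)_{n₀}` lies in the span of the functionals `h ↦ (K(h) G_c)_n`
  have hspan : ((LinearMap.proj n₀).comp (Φ eb) : (Fin p → Fin N → ℂ) →ₗ[ℂ] ℂ) ∈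
      Submodule.span ℂ (Set.range fun q : Fin m × Fin N =>
        ((LinearMap.proj q.2).comp (Φ (G q.1)) : (Fin p → Fin N → ℂ) →ₗ[ℂ] ℂ)) := by
    apply mem_span_of_iInf_ker_le_ker
    intro Hf hHf
    have hc : ∀ c : Fin m, (∑ k : Fin p, (L k * (∑ i : Fin N, Hf k i •
        (Matrix.of fun i j : Fin N => if (i : ℕ) = (j : ℕ) + 1 then (1 : ℂ) else 0)ᵀ ^ (i : ℕ)))) *ᵥ
          (G c) = 0 := by
      intro c
      funext n
      have h := (Submodule.mem_iInf _).mp hHf (c, n)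
      simp only [LinearMap.mem_ker, LinearMap.comp_apply, hΦ, LinearMap.proj_apply] at h
      exact h
    simp only [LinearMap.mem_ker, LinearMap.comp_apply, hΦ, LinearMap.proj_apply, hprimal Hf hc,
      Pi.zero_apply]
  obtain ⟨coef, hcoef⟩ := (Submodule.mem_span_range_iff_exists_fun ℂ).mp hspan
  refine ⟨Matrix.of fun n c => coef (c, n), fun k => ?_⟩
  -- pair both sides with an arbitrary `h` and extract the `k`-component
  have key : ∀ Hf : Fin p → Fin N → ℂ,
      ∑ k : Fin p, Hf k ⬝ᵥ (∑ c : Fin m, (∑ j : Fin N,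
          ((A k *ᵥ ((Matrix.of fun (n : Fin N) (c : Fin m) => coef (c, n))ᵀ c)) j) •
          (Matrix.of fun i j : Fin N => if (i : ℕ) = (j : ℕ) + 1 then (1 : ℂ) else 0)ᵀ ^ (j : ℕ)) *ᵥ
        (G c)) =
      ∑ k : Fin p, Hf k ⬝ᵥ ((∑ j : Fin N, ((A k *ᵥ (Pi.single n₀ 1)) j) •
          (Matrix.of fun i j : Fin N => if (i : ℕ) = (j : ℕ) + 1 then (1 : ℂ) else 0)ᵀ ^ (j : ℕ)) *ᵥ
        eb) := by
    intro Hf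
    have h := LinearMap.congr_fun hcoef Hf
    simp only [LinearMap.sum_apply, LinearMap.smul_apply, LinearMap.comp_apply,
      LinearMap.proj_apply, hΦ, smul_eq_mul] at h
    have hl : ∀ c : Fin m, ∑ n : Fin N, coef (c, n) * ((∑ k : Fin p, (L k * (∑ i : Fin N, Hf k i •
        (Matrix.of fun i j : Fin N => if (i : ℕ) = (j : ℕ) + 1 then (1 : ℂ) else 0)ᵀ ^ (i : ℕ)))) *ᵥ
          (G c)) n =
        ∑ k : Fin p, Hf k ⬝ᵥ ((∑ j : Fin N,
          ((A k *ᵥ ((Matrix.of fun (n : Fin N) (c : Fin m) => coef (c, n))ᵀ c)) j) •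
          (Matrix.of fun i j : Fin N => if (i : ℕ) = (j : ℕ) + 1 then (1 : ℂ) else 0)ᵀ ^ (j : ℕ)) *ᵥ
        (G c)) := by
      intro c
      have hp :=
        hclR_ss_pairing L ((Matrix.of fun (n : Fin N) (c : Fin m) => coef (c, n))ᵀ c) (G c) Hf
      simp only [hA] at hp
      rw [← hp]
      rfl
    have hr : ((∑ k : Fin p, (L k * (∑ i : Fin N, Hf k i •
        (Matrix.of fun i j : Fin N => if (i : ℕ) = (j : ℕ) + 1 then (1 : ℂ) else 0)ᵀ ^ (i : ℕ)))) *ᵥ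
          eb) n₀ =
        ∑ k : Fin p, Hf k ⬝ᵥ ((∑ j : Fin N, ((A k *ᵥ (Pi.single n₀ 1)) j) •
          (Matrix.of fun i j : Fin N => if (i : ℕ) = (j : ℕ) + 1 then (1 : ℂ) else 0)ᵀ ^ (j : ℕ)) *ᵥ
        eb) := by
      have hp := hclR_ss_pairing L (Pi.single n₀ 1) eb Hf
      simp only [hA] at hp
      rw [← hp, single_dotProduct, one_mul]
    rw [Fintype.sum_prod_type] at h
    simp only [hl, hr] at h
    simp_rw [dotProduct_sum]
    rw [Finset.sum_comm]
    exact h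
  have hXY := hclR_ss_ext_of_pairing _ _ key
  exact congr_fun hXY k

/-- If `h` vanishes in degrees `≤ D` and `e` vanishes in degrees `> D`, then `U(h) e = 0`
(`(U(h) e)_n = Σ_j h j · e (n + j)`, `hclR_upperToeplitz_mulVec_apply`). -/
theorem hclR_ss_upperToeplitz_kills {N : ℕ} (D : ℕ) (h e : Fin N → ℂ)
    (hh : ∀ n : Fin N, (n : ℕ) ≤ D → h n = 0) (he : ∀ n : Fin N, D < (n : ℕ) → e n = 0) :
    (∑ j : Fin N, h j •
        (Matrix.of fun i j : Fin N => if (i : ℕ) = (j : ℕ) + 1 then (1 : ℂ) else 0)ᵀ ^ (j : ℕ)) *ᵥ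
      e = 0 := by
  funext n
  rw [hclR_upperToeplitz_mulVec_apply, Pi.zero_apply]
  refine Finset.sum_eq_zero fun j _ => ?_
  by_cases hj : (j : ℕ) ≤ D
  · rw [hh j hj, zero_mul]
  · by_cases hn : (n : ℕ) + (j : ℕ) < N
    · rw [dif_pos hn, he _ (by show D < (n : ℕ) + (j : ℕ); omega), mul_zero]
    · rw [dif_neg hn, mul_zero]

/-- `L(g_k)ᵀ = A_k`: the transpose of `Σ_i G₀ i k • Z^i` is `Σ_i G₀ i k • (Zᵀ)^i`. -/
theorem hclR_ss_transpose_L {N p : ℕ} (G₀ : Matrix (Fin N) (Fin p) ℂ) (k : Fin p) :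
    (∑ i : Fin N, G₀ i k •
        (Matrix.of fun i j : Fin N => if (i : ℕ) = (j : ℕ) + 1 then (1 : ℂ) else 0) ^ (i : ℕ))ᵀ =
      ∑ i : Fin N, G₀ i k •
        (Matrix.of fun i j : Fin N => if (i : ℕ) = (j : ℕ) + 1 then (1 : ℂ) else 0)ᵀ ^ (i : ℕ) := by
  rw [Matrix.transpose_sum]
  refine Finset.sum_congr rfl fun i _ => ?_
  rw [Matrix.transpose_smul, Matrix.transpose_pow]

/-- An injection `ι : Fin m → Fin r` with `m < r` misses some `b : Fin r`. -/
theorem hclR_ss_exists_avoid {r m : ℕ} (ι : Fin m → Fin r) (hι : Function.Injective ι)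
    (hmr : m < r) : ∃ b : Fin r, ∀ i : Fin m, ι i ≠ b := by
  by_contra h
  push Not at h
  have hbij : Function.Bijective ι := ⟨hι, fun b => h b⟩
  have hcard := Fintype.card_of_bijective hbij
  simp only [Fintype.card_fin] at hcard
  omega

-- the registered binders `H`, `X₀`, `hM` etc. are named inside the `∀`
set_option linter.unusedVariables false in
/-- **Kernel lemma (stub `hclR_short_syzygy_of_subframe`).**  Data of the G-constant dual law
(constant generators `G₀ : N × p`, frame `E` and targets `F` of rank `r`, the annihilator
hypothesis, a class member `M` — `M - Z M Zᵀ = G₀ Hᵀ` — with `M E = F X₀` and `det M ≠ 0`), an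
injective `ι : Fin m → Fin r` with `m < r` (a proper subframe `E.submatrix id ι`), a degree bound
`D` for the columns of `E`, and the window hypothesis for the column span of the subframe (every
window `[τ, τ + w)`, `τ ≤ D`, contains the degree of one of its vectors).  Then the generators admit
a NONZERO short syzygy: `β_k` supported in degrees `< w` with `Σ_k L(g_k) β_k = 0`
(`L(g_k) = Σ_i G₀ i k • Z^i`, `Z` the lower shift written verbatim). -/
theorem hclR_short_syzygy_of_subframe : ∀ (N p r m w D : ℕ) (G₀ : Matrix (Fin N) (Fin p) ℂ)
    (E F : Matrix (Fin N) (Fin r) ℂ) (M : Matrix (Fin N) (Fin N) ℂ) (H : Matrix (Fin N) (Fin p) ℂ)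
    (X₀ : Matrix (Fin r) (Fin r) ℂ) (ι : Fin m → Fin r), E.rank = r → F.rank = r →
    (∀ Λ : Matrix (Fin N) (Fin r) ℂ, (∀ k : Fin p, (∑ c : Fin r, (∑ j : Fin N, (((∑ i : Fin N,
    G₀ i k • (Matrix.of fun i j : Fin N => if (i : ℕ) = (j : ℕ) + 1 then (1 : ℂ) else 0)ᵀ ^ (i : ℕ))
    *ᵥ (Λᵀ c)) j) • (Matrix.of fun i j : Fin N => if (i : ℕ) = (j : ℕ) + 1 then (1 : ℂ) else 0)ᵀ ^
    (j : ℕ)) *ᵥ (Eᵀ c)) = 0) → Λᵀ * F = 0) → M - (Matrix.of fun i j : Fin N => if (i : ℕ) = (j : ℕ)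
    + 1 then (1 : ℂ) else 0) * M * (Matrix.of fun i j : Fin N => if (i : ℕ) = (j : ℕ) + 1 then (1 :
    ℂ) else 0)ᵀ = G₀ * Hᵀ → M * E = F * X₀ → M.det ≠ 0 → Function.Injective ι → m < r →
    (∀ (c : Fin r) (n : Fin N), D < (n : ℕ) → E n c = 0) → (∀ τ : ℕ, τ ≤ D → ∃ v ∈ Submodule.span ℂ
    (Set.range (E.submatrix id ι).col), ∃ d : Fin N, τ ≤ (d : ℕ) ∧ (d : ℕ) < τ + w ∧ v d ≠ 0 ∧
    ∀ n : Fin N, (d : ℕ) < (n : ℕ) → v n = 0) → ∃ β : Fin p → (Fin N → ℂ), (∀ (k : Fin p)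
    (n : Fin N), w ≤ (n : ℕ) → β k n = 0) ∧ (∑ k : Fin p, (∑ i : Fin N, G₀ i k •
    (Matrix.of fun i j : Fin N => if (i : ℕ) = (j : ℕ) + 1 then (1 : ℂ) else 0) ^ (i : ℕ)) *ᵥ β k) =
    0 ∧ β ≠ 0 := by
  intro N p r m w D G₀ E F M H X₀ ι hE hF hann hM hME hdet hι hmr hdeg hwin
  by_contra hno
  -- (1) no nonzero short syzygy is the scale-vanishing hypothesis of the level theorem
  have hsv : ∀ β : Fin p → (Fin N → ℂ), (∀ (k : Fin p) (n : Fin N), w ≤ (n : ℕ) → β k n = 0) →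
      (∑ k : Fin p, (∑ i : Fin N, G₀ i k •
        (Matrix.of fun i j : Fin N => if (i : ℕ) = (j : ℕ) + 1 then (1 : ℂ) else 0) ^ (i : ℕ)) *ᵥ
          β k) = 0 → β = 0 := by
    intro β h1 h2
    by_contra h3
    exact hno ⟨β, h1, h2, h3⟩
  -- the columns of the subframe are columns of `E`, so they obey the degree bound
  have hdeg' : ∀ (c : Fin m) (n : Fin N), D < (n : ℕ) → (E.submatrix id ι) n c = 0 :=
    fun c n hn => hdeg (ι c) n hn
  -- (2) primal kernel containment: a class member killing the subframe kills every column of `E`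
  have hprimal : ∀ Hf : Fin p → Fin N → ℂ,
      (∀ c : Fin m, (∑ k : Fin p, ((∑ i : Fin N, G₀ i k •
          (Matrix.of fun i j : Fin N => if (i : ℕ) = (j : ℕ) + 1 then (1 : ℂ) else 0) ^ (i : ℕ)) *
        (∑ i : Fin N, Hf k i •
          (Matrix.of fun i j : Fin N => if (i : ℕ) = (j : ℕ) + 1 then (1 : ℂ) else 0)ᵀ ^ (i : ℕ))))
        *ᵥ ((E.submatrix id ι)ᵀ c) = 0) →
      ∀ b : Fin r, (∑ k : Fin p, ((∑ i : Fin N, G₀ i k •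
          (Matrix.of fun i j : Fin N => if (i : ℕ) = (j : ℕ) + 1 then (1 : ℂ) else 0) ^ (i : ℕ)) *
        (∑ i : Fin N, Hf k i •
          (Matrix.of fun i j : Fin N => if (i : ℕ) = (j : ℕ) + 1 then (1 : ℂ) else 0)ᵀ ^ (i : ℕ))))
        *ᵥ (Eᵀ b) = 0 := by
    intro Hf hker b
    have hH : ∀ (k : Fin p) (n : Fin N), (n : ℕ) ≤ D → Hf k n = 0 :=
      hclR_kernel_trivial_of_scaleVanishing N p m w D G₀ (E.submatrix id ι) Hf hdeg' hwin hsv hker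
    rw [Matrix.sum_mulVec]
    refine Finset.sum_eq_zero fun k _ => ?_
    rw [← Matrix.mulVec_mulVec, hclR_ss_upperToeplitz_kills D (Hf k) (Eᵀ b) (hH k)
      (fun n hn => hdeg b n hn), Matrix.mulVec_zero]
  -- (3) + (4): a column `b` outside the subframe; dualise; absorb
  obtain ⟨b, hιb⟩ := hclR_ss_exists_avoid ι hι hmr
  have hF0 : F = 0 := by
    ext n₀ a
    obtain ⟨Λ, hΛ⟩ := hclR_ss_dualise
      (fun k => ∑ i : Fin N, G₀ i k •
        (Matrix.of fun i j : Fin N => if (i : ℕ) = (j : ℕ) + 1 then (1 : ℂ) else 0) ^ (i : ℕ))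
      (fun k => ∑ i : Fin N, G₀ i k •
        (Matrix.of fun i j : Fin N => if (i : ℕ) = (j : ℕ) + 1 then (1 : ℂ) else 0)ᵀ ^ (i : ℕ))
      (fun k => hclR_ss_transpose_L G₀ k) (fun c => (E.submatrix id ι)ᵀ c) (Eᵀ b) n₀
      (fun Hf hc => hprimal Hf hc b)
    have hΛF : ((Matrix.of fun (n : Fin N) (c : Fin r) =>
          ∑ i : Fin m, if ι i = c then Λ n i else 0) +
        (Matrix.of fun (n : Fin N) (c : Fin r) =>
          if c = b then (-(Pi.single n₀ 1 : Fin N → ℂ)) n else 0))ᵀ * F = 0 := by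
      apply hann
      intro k
      have hsplit : ∀ (P Q : Matrix (Fin N) (Fin r) ℂ) (c : Fin r), (P + Q)ᵀ c = Pᵀ c + Qᵀ c :=
        fun P Q c => rfl
      simp only [hsplit, hclR_phi_T_add, Finset.sum_add_distrib]
      rw [hclR_phi_sum_extend_fin, hclR_phi_sum_single, hclR_phi_T_neg, ← sub_eq_add_neg,
        sub_eq_zero]
      exact hΛ k
    have h := congrFun (congrFun hΛF b) a
    simpa [Matrix.mul_apply, hιb, Pi.single_apply] using h
  have h0 : F.rank = 0 := by rw [hF0, Matrix.rank_zero]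
  omega

end Summit.MatrixMultiplication.MatrixMultiplication.Theorems
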